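import Mathlib.MeasureTheory.Measure.Haar.Unique
import Mathlib.MeasureTheory.Constructions.Pi
import Mathlib.MeasureTheory.Measure.Prod
import Literature.MeasureTheory.Group.HaarLocalChart
import HarnessLib

/-!
# Route `FluctuationComparisonRegPrIntL` (stmt-QuantumFields-20520), LINE g18-1 S2β LAPLACE, letter (C3) — THE TREE GAUGE, I: ALGEBRA
# (a rooted gauge fixing on a finite graph: every configuration is UNIQUELY a root-trivial gauge transform of a comb-trivial one)

Cell `ym3-torus` (HUMAN RULING D-0037 — YM₃ on T³ is ladder rung R3, not the Clay problem), width seat `ym3-torus-px21` g9; count-neutral helper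
(`--kind proof --supports stmt-QuantumFields-20520 --as helper`).  Theorems only: 0 `def`, 0 `instance`, 0 `notation`, 0 `sorry`.

THE SETTING (all data displayed; shared with part II `…S2BetaTreeGaugeHaar`).  A finite graph: sites `ι`, bonds `β`, end points `s t : β → ι`; a group `G`;
the GAUGE ACTION of `a : ι → G` on `V : β → G`, `(a • V) b = a (s b) · V b · (a (t b))⁻¹` (spelled out); ROOTS `R ⊆ ι`, COMB BONDS `F ⊆ β`; a TRANSPORTER
`g : (β → G) → (ι → G)` (in the application: the holonomy along the coordinate comb from the centre of the block of `x` to `x`, [Balaban1985Variational] (19)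
p.281 «exactly one gauge transformation u satisfying R̄₀uʲ = 1», lit `T4RootedResidualGauge`) subject to the TREE-GAUGE AXIOMS: trivial at the roots (`hgR`),
covariant under root-trivial transformations `g (a • V) x = g V x · (a x)⁻¹` (`hcov`), COMB-KILLING `(g V • V) b = 1` on `F` (`hkill`), LOCAL (`hloc`), `g 1 = 1`.

WHAT IS PROVED.  With `Ξ(w, u) := ŵ • û` (`ŵ` = `w` extended by `1` on the roots, `û` = `u` extended by `1` on the comb) and
`Ψ(V) := ((g V ·)⁻¹ off the roots, (g V • V) off the comb)`: §1 `act_mul`, ★ `xi_psi` (`Ξ ∘ Ψ = id`), ★ `psi_xi` (`Ψ ∘ Ξ = id`); §1b `continuous_xi`,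
`measurable_xi`, `measurable_psi`.  Part II proves that `Ψ`, `Ξ` are MEASURE-PRESERVING between product Haar measures.

HONEST SCOPE.  Finite-dimensional group bookkeeping ([folklore]: complete axial ∕ tree gauge); nothing of Bałaban's analysis; (C3) ∕ LAPLACE ∕ S2β ∕
stmt-QuantumFields-20520 NOT proved here; rung R3 = YM₃ on T³ — NOT d = 4, NOT infinite volume, NOT a mass gap, NOT Clay.
-/

noncomputable section

open MeasureTheory MeasureTheory.Measure Set Function Filter
open scoped ENNReal

namespace Summit.QuantumFields.YangMills.Theorems.FluctuationComparisonRegPrIntLS2BetaTreeGaugeAlgebra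

variable {ι β G : Type*} [Group G]

/-! ## §1  Algebra of the tree gauge: `Ξ ∘ Ψ = id`, `Ψ ∘ Ξ = id` -/

section Algebra

variable (s t : β → ι) (R : Set ι) [DecidablePred (· ∈ R)] (F : Set β) [DecidablePred (· ∈ F)]
  (g : (β → G) → (ι → G))

/-- The gauge action is a left action: `(a·a') • V = a • (a' • V)` (bondwise). [folklore] -/
theorem act_mul (a a' : ι → G) (V : β → G) :
    (fun b => (a * a') (s b) * V b * ((a * a') (t b))⁻¹) =
      fun b => a (s b) * (a' (s b) * V b * (a' (t b))⁻¹) * (a (t b))⁻¹ := by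
  funext b
  simp only [Pi.mul_apply, mul_inv_rev, mul_assoc]

/-- ★ **EVERY CONFIGURATION IS A ROOT-TRIVIAL GAUGE TRANSFORM OF ITS COMB-TRIVIAL NORMAL FORM**: `Ξ (Ψ V) = V`, i.e.
`(g V)⁻¹ • (g V • V) = V`, where the comb coordinates of `g V • V` are `1` (`hkill`) so that only the off-comb coordinates are recorded, and `g V = 1` at the
roots (`hgR`) so that only the off-root values are recorded. [cite: Balaban1985Variational, (19) p.281] -/
theorem xi_psi (hgR : ∀ V, ∀ r ∈ R, g V r = 1) (hkill : ∀ V, ∀ b ∈ F, g V (s b) * V b * (g V (t b))⁻¹ = 1) (V : β → G) :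
    (fun b =>
        (fun x : ι => if hx : x ∈ R then (1 : G) else ((fun x : {x // x ∉ R} => (g V x)⁻¹) ⟨x, hx⟩)) (s b) *
          (fun b : β => if hb : b ∈ F then (1 : G) else
              ((fun b : {b // b ∉ F} => g V (s b) * V b * (g V (t b))⁻¹) ⟨b, hb⟩)) b *
        ((fun x : ι => if hx : x ∈ R then (1 : G) else ((fun x : {x // x ∉ R} => (g V x)⁻¹) ⟨x, hx⟩)) (t b))⁻¹) = V := by
  funext b
  -- the extended transformation IS `(g V ·)⁻¹` everywhere (at the roots both are `1`)
  have hext : ∀ x, (if hx : x ∈ R then (1 : G) else (g V x)⁻¹) = (g V x)⁻¹ := by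
    intro x
    by_cases hx : x ∈ R
    · rw [dif_pos hx, hgR V x hx, inv_one]
    · rw [dif_neg hx]
  simp only [hext]
  by_cases hb : b ∈ F
  · rw [dif_pos hb]
    have h := hkill V b hb
    -- `g(s)·V·g(t)⁻¹ = 1` ⇒ `V = g(s)⁻¹·g(t)`
    have hV : V b = (g V (s b))⁻¹ * g V (t b) := by
      have h2 : g V (s b) * V b = g V (t b) := by
        calc g V (s b) * V b = g V (s b) * V b * (g V (t b))⁻¹ * g V (t b) := by rw [inv_mul_cancel_right]
          _ = g V (t b) := by rw [h, one_mul]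
      rw [← h2, ← mul_assoc, inv_mul_cancel, one_mul]
    rw [hV, mul_one, inv_inv]
  · rw [dif_neg hb]
    simp only [inv_inv, ← mul_assoc, inv_mul_cancel, one_mul, inv_mul_cancel_right]

/-- ★ **… AND UNIQUELY SO**: `Ψ (Ξ (w, u)) = (w, u)` — the transporter of `ŵ • û` is `ŵ⁻¹` (covariance `hcov` + `g û = g 1 = 1` by locality, `û = 1` on the
comb), so the recorded off-root values are `w` and the recorded off-comb coordinates of `ŵ⁻¹ • (ŵ • û) = û` are `u`. [cite: Balaban1985Variational, (19) p.281] -/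
theorem psi_xi (hcov : ∀ (a : ι → G), (∀ r ∈ R, a r = 1) → ∀ (V : β → G) (x : ι),
      g (fun b => a (s b) * V b * (a (t b))⁻¹) x = g V x * (a x)⁻¹)
    (hloc : ∀ V V' : β → G, (∀ b ∈ F, V b = V' b) → g V = g V') (hg1 : g (fun _ => 1) = fun _ => 1)
    (w : {x // x ∉ R} → G) (u : {b // b ∉ F} → G) :
    ((fun x : {x // x ∉ R} =>
        (g (fun b => (fun x : ι => if hx : x ∈ R then (1 : G) else w ⟨x, hx⟩) (s b) *
            (fun b : β => if hb : b ∈ F then (1 : G) else u ⟨b, hb⟩) b *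
            ((fun x : ι => if hx : x ∈ R then (1 : G) else w ⟨x, hx⟩) (t b))⁻¹) x)⁻¹),
      (fun b : {b // b ∉ F} =>
        g (fun b => (fun x : ι => if hx : x ∈ R then (1 : G) else w ⟨x, hx⟩) (s b) *
            (fun b : β => if hb : b ∈ F then (1 : G) else u ⟨b, hb⟩) b *
            ((fun x : ι => if hx : x ∈ R then (1 : G) else w ⟨x, hx⟩) (t b))⁻¹) (s b) *
          ((fun x : ι => if hx : x ∈ R then (1 : G) else w ⟨x, hx⟩) (s b) *
            (fun b : β => if hb : b ∈ F then (1 : G) else u ⟨b, hb⟩) b *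
            ((fun x : ι => if hx : x ∈ R then (1 : G) else w ⟨x, hx⟩) (t b))⁻¹) *
          (g (fun b => (fun x : ι => if hx : x ∈ R then (1 : G) else w ⟨x, hx⟩) (s b) *
            (fun b : β => if hb : b ∈ F then (1 : G) else u ⟨b, hb⟩) b *
            ((fun x : ι => if hx : x ∈ R then (1 : G) else w ⟨x, hx⟩) (t b))⁻¹) (t b))⁻¹)) = (w, u) := by
  set a : ι → G := fun x => if hx : x ∈ R then (1 : G) else w ⟨x, hx⟩ with ha
  set U : β → G := fun b => if hb : b ∈ F then (1 : G) else u ⟨b, hb⟩ with hU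
  have haR : ∀ r ∈ R, a r = 1 := fun r hr => by simp [ha, hr]
  -- the transporter of the comb-trivial `û` is trivial, hence that of `ŵ • û` is `ŵ⁻¹`
  have hgU : g U = fun _ => 1 := by
    rw [← hg1]
    exact hloc U _ fun b hb => by simp [hU, hb]
  have hg : ∀ x, g (fun b => a (s b) * U b * (a (t b))⁻¹) x = (a x)⁻¹ := by
    intro x
    rw [hcov a haR U x, hgU, one_mul]
  refine Prod.ext ?_ ?_
  · funext x
    show (g (fun b => a (s b) * U b * (a (t b))⁻¹) x)⁻¹ = w x
    rw [hg, inv_inv]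
    show (if hx : (x : ι) ∈ R then (1 : G) else w ⟨x, hx⟩) = w x
    rw [dif_neg x.2]
  · funext b
    show g (fun b => a (s b) * U b * (a (t b))⁻¹) (s b) * (a (s b) * U b * (a (t b))⁻¹) *
        (g (fun b => a (s b) * U b * (a (t b))⁻¹) (t b))⁻¹ = u b
    rw [hg, hg, inv_inv]
    simp only [← mul_assoc, inv_mul_cancel, one_mul, inv_mul_cancel_right]
    show (if hb : (b : β) ∈ F then (1 : G) else u ⟨b, hb⟩) = u b
    rw [dif_neg b.2]

end Algebra

/-! ## §2  Measure: `Ψ` and `Ξ` carry product Haar measure to∕from the product of the two product Haar measures -/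

section Topology

variable [TopologicalSpace G] [IsTopologicalGroup G]
variable (s t : β → ι) (R : Set ι) [DecidablePred (· ∈ R)] (F : Set β) [DecidablePred (· ∈ F)]

/-- `Ξ` is continuous. [folklore] -/
theorem continuous_xi :
    Continuous (fun p : ({x // x ∉ R} → G) × ({b // b ∉ F} → G) => fun b : β =>
      (fun x : ι => if hx : x ∈ R then (1 : G) else p.1 ⟨x, hx⟩) (s b) *
        (fun b : β => if hb : b ∈ F then (1 : G) else p.2 ⟨b, hb⟩) b *
        ((fun x : ι => if hx : x ∈ R then (1 : G) else p.1 ⟨x, hx⟩) (t b))⁻¹) := by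
  refine continuous_pi fun b => ?_
  have hR : ∀ x : ι, Continuous fun p : ({x // x ∉ R} → G) × ({b // b ∉ F} → G) =>
      (if hx : x ∈ R then (1 : G) else p.1 ⟨x, hx⟩) := by
    intro x
    by_cases hx : x ∈ R
    · simp only [dif_pos hx]; exact continuous_const
    · simp only [dif_neg hx]; exact (continuous_apply _).comp continuous_fst
  have hF : Continuous fun p : ({x // x ∉ R} → G) × ({b // b ∉ F} → G) =>
      (if hb : b ∈ F then (1 : G) else p.2 ⟨b, hb⟩) := by
    by_cases hb : b ∈ F
    · simp only [dif_pos hb]; exact continuous_const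
    · simp only [dif_neg hb]; exact (continuous_apply _).comp continuous_snd
  exact ((hR (s b)).mul hF).mul (hR (t b)).inv

end Topology

section Measurability

variable [MeasurableSpace G] [MeasurableMul₂ G] [MeasurableInv G]
variable (s t : β → ι) (R : Set ι) [DecidablePred (· ∈ R)] (F : Set β) [DecidablePred (· ∈ F)]
  (g : (β → G) → (ι → G))

/-- `Ξ` is measurable (indeed continuous: finitely many products of coordinates). [folklore] -/
theorem measurable_xi :
    Measurable (fun p : ({x // x ∉ R} → G) × ({b // b ∉ F} → G) => fun b : β =>
      (fun x : ι => if hx : x ∈ R then (1 : G) else p.1 ⟨x, hx⟩) (s b) *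
        (fun b : β => if hb : b ∈ F then (1 : G) else p.2 ⟨b, hb⟩) b *
        ((fun x : ι => if hx : x ∈ R then (1 : G) else p.1 ⟨x, hx⟩) (t b))⁻¹) := by
  refine measurable_pi_iff.2 fun b => ?_
  have hR : ∀ x : ι, Measurable fun p : ({x // x ∉ R} → G) × ({b // b ∉ F} → G) =>
      (if hx : x ∈ R then (1 : G) else p.1 ⟨x, hx⟩) := by
    intro x
    by_cases hx : x ∈ R
    · simp only [dif_pos hx]; exact measurable_const
    · simp only [dif_neg hx]; exact (measurable_pi_apply _).comp measurable_fst
  have hF : Measurable fun p : ({x // x ∉ R} → G) × ({b // b ∉ F} → G) =>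
      (if hb : b ∈ F then (1 : G) else p.2 ⟨b, hb⟩) := by
    by_cases hb : b ∈ F
    · simp only [dif_pos hb]; exact measurable_const
    · simp only [dif_neg hb]; exact (measurable_pi_apply _).comp measurable_snd
  exact ((hR (s b)).mul hF).mul (hR (t b)).inv

omit [DecidablePred (· ∈ R)] [DecidablePred (· ∈ F)] in
/-- `Ψ` is measurable when the transporter is. [folklore] -/
theorem measurable_psi (hgm : Measurable g) :
    Measurable (fun V : β → G =>
      ((fun x : {x // x ∉ R} => (g V x)⁻¹), (fun b : {b // b ∉ F} => g V (s b) * V b * (g V (t b))⁻¹))) := by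
  have hg : ∀ x : ι, Measurable fun V : β → G => g V x := fun x => (measurable_pi_apply x).comp hgm
  refine Measurable.prodMk (measurable_pi_iff.2 fun x => (hg x).inv) (measurable_pi_iff.2 fun b => ?_)
  exact ((hg (s b)).mul (measurable_pi_apply _)).mul (hg (t b)).inv

end Measurability

end Summit.QuantumFields.YangMills.Theorems.FluctuationComparisonRegPrIntLS2BetaTreeGaugeAlgebra

end
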